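import Summits.Ventures.HodgeRepro.Night1ProductWeilSpace
import Summits.Ventures.HodgeRepro.ProdTransfer

/-!
# S3 (André 1992 = Milne 2020 Theorem 1) on the kernel: the pull-back `f_Δ^*` of the Weil space of the
corner product `A_Δ` along the diagonal, on the `G`-set model — every Hodge class of a CM abelian variety
is a sum of pulled-back Weil classes

Blind re-derivation cell `pub-hodge-repro`, seat `night-1` (gen 6).  Imports night-1's
`Night1ProductWeilSpace` (p377610: the `σ`-lines `weilWedgeProd e σ` and the Weil space
`weilSpaceProd G p e = span {σ-lines}` of a corner product on the `G`-set `ι × G`, the Galois action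
`galProd`) and typer's `ProdTransfer` (`IsTypeMap`: Pohlmann's criterion transfers along a `G`-equivariant
type-compatible map `ρ : J × G → X` injective on the set).  Namespace `HodgeRepro.RouteC`.

ROUTE.md §1 row **S3 (André 1992)**: «Every `t ∈ B^p(A)` is a finite sum `t = Σ_Δ f_Δ^*(t_Δ)` with
`t_Δ ∈ W_F(A_Δ)` a split Weil class» — PRINTED, the primary not held; the held proof is Milne 2020,
*Hodge classes on abelian varieties*, arXiv:2010.08857 (store `paper:arxiv-2010.08857`), Theorem 1
p0005:L3–8 and its proof p0005:L10–76 (read by the seat 2026-08-24T17:2xZ), verbatim at the steps this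
file formalises:

* p0005:L22–23: «Fix a subset `Δ` of `S := Hom(E, F)` satisfying ((eq2)). For `s ∈ Δ`, let
  `A_s = A ⊗_{E,s} F`. Then `A_s` is an abelian variety of CM type `(F, φ_s)`, where `φ_s(t) = φ(t ∘ s)`
  for `t ∈ T`.»  — `cornerType Φ s = {t ∈ G : t • s ∈ Φ}`, `cornerFamily Φ Δ`;
* p0005:L26–34: «Because `Δ` satisfies ((eq2)), `Σ_{s∈Δ} φ_s(t) = p`, all `t ∈ T`, and so we can apply
  (r3): the abelian variety `A_Δ := ∏_{s∈Δ} A_s` … is of split Weil type.» — `sumP_cornerFamily`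
  (`IsHodgeSetOn c Φ Δ ⟺ SumP (|Δ|/2) (cornerFamily Φ Δ)`, `isHodgeSetOn_iff_sumP_cornerFamily`);
* p0005:L34–45: «There is a homomorphism `f_Δ : A → A_Δ` such that `f_{Δ*} : H₁(A, ℚ) → H₁(A_Δ, ℚ) ≃
  H₁(A, ℚ) ⊗_E F^Δ` is `x ↦ x ⊗ 1`. … The map `f_Δ^* : H¹(A_Δ, ℚ) → H¹(A, ℚ)` is the `E`-linear dual of
  `f_{Δ*}`.» — in the eigen-coordinates of the model (`H¹(A) ⊗ ℂ = ℂ^X`, `H¹(A_Δ) ⊗ ℂ = ℂ^{Δ × G}`,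
  Deligne LNM 900 Ex. 3.7) `f_Δ^*` is the push-forward `e_{(s,t)} ↦ e_{t • s}` along
  `andreMap Δ : Δ × G → X`, `(s, t) ↦ t • s` (`pushMap`, `andrePull`) — the eigen-coordinates of `A_Δ`
  being normalised by `f_Δ^*` itself (only the eigenLINES are canonical; the printed sentence is
  «maps `H^{2p}(A_Δ)_{Δ×{t}}` into `H^{2p}(A)_{t∘Δ}`», and `f_Δ^*` is non-zero on each line since
  `f_{Δ*}` is injective on each `x`-eigenline);
* p0005:L57–66: «`W_F(A_Δ) ⊗ ℚ^al = ⊕_{t∈T} H^{2p}(A_Δ)_{Δ×{t}}` … Therefore `f_Δ^* ⊗ 1 :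
  H^{2p}(A_Δ) → H^{2p}(A)` maps `H^{2p}(A_Δ)_{Δ×{t}}` into `H^{2p}(A)_{t∘Δ} ⊂ B^p(A) ⊗ ℚ^al`.» —
  **`andrePull_weilWedgeProd`**: the `σ`-line of `W_F(A_Δ)` is carried to the coordinate wedge
  `e_{σ • Δ}` (`deltaEnum`), a Pohlmann wedge of `A` (`coordWedgeOn_deltaEnum_mem_jointEigenspaceOn`);
* p0005:L67–76: «`f_Δ^*(W_F(A_Δ)) ⊗ ℚ^al` is contained in `B^p(A) ⊗ ℚ^al` and contains
  `H^{2p}(A)_Δ`. As the subspaces `H^{2p}(A)_Δ` span `B^p ⊗ ℚ^al` (see (r4)(c)), this implies that the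
  subspaces `f_Δ^*(W_F(A_Δ))` span `B^p`.» — **`map_andrePull_weilSpaceProd`** (the image of the Weil
  space is the span of the Galois orbit `{e_{σ • Δ}}`), `map_andrePull_weilSpaceProd_le`
  (⊆ the joint `(p, p)`-eigenspace of the conjugate cocharacters `μ_{g • Φ}` = `B^p(A) ⊗ ℂ` in typer-2's
  dictionary), `coordWedgeOn_deltaEnum_mem_map` (∋ `e_Δ`), and **`jointEigenspaceOn_eq_iSup_map_andrePull`**
  — Theorem 1 complexified, on the kernel: with typer-2's S2 (`jointEigenspaceOn_smul_eq_span_pohlmannWedgesOn`,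
  (r4)(c) = Pohlmann's census) the space of Hodge classes of `A` is the sum over the Pohlmann `2p`-sets
  `Δ ⊆ X` of the pulled-back Weil spaces `f_Δ^*(W_F(A_Δ))`.

Model.  `X` a finite `G`-set (the embeddings `Hom(E, ℂ)` of the CM algebra `E` of `A`, `G = Gal(F/ℚ)`
for a Galois CM field `F` splitting `E`; typer's `GSetHodge.lean` / `Induced.lean`), `c ∈ G` the complex
conjugation, `Φ ⊆ X` the CM type of `A` (`IsCMTypeOn c Φ`), `Δ ⊆ X` a subset; the corner product
`A_Δ = ∏_{s ∈ Δ} A_s` has CM algebra `F^Δ` with embeddings `Δ × G` and corner family `cornerFamily Φ Δ`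
(night-1's model of the full corner product, `Night1ProductWeilLineEigen`).  The Galois equivariance
of `f_Δ^*` and the stability of the pulled-back Weil spaces are the next file, `Night1AndreGalois`.

Nothing geometric is built: the varieties `A`, `A_s`, the homomorphism `f_Δ` and the identifications
`H¹ ⊗ ℂ = ℂ^X` are the printed dictionary (NIGHT1.md §12); every theorem here is a statement about
coordinate wedges on finite `G`-sets.  Nothing here says anything about the status of the Hodge conjecture
for CM abelian varieties, which is NOT proved.
-/

set_option autoImplicit false

open Finset Module
open scoped Pointwise

namespace HodgeRepro.RouteC

open CMHodgeOn

/-! ### The push-forward along a map of finite sets -/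

section Push

variable {Y X : Type*} [Fintype Y] [DecidableEq Y] [DecidableEq X]

/-- The push-forward along `ρ : Y → X` on coordinate functions, `e_y ↦ e_{ρ y}`: the `ℂ`-linear map
`ℂ^Y → ℂ^X`, `w ↦ Σ_y w(y) e_{ρ y}`.  In the model this is `f_Δ^*` on `H¹` — the `E`-linear dual of
`x ↦ x ⊗ 1` (Milne 2020 p0005:L36–45) — read in the eigen-coordinates. -/
noncomputable def pushMap (ρ : Y → X) : (Y → ℂ) →ₗ[ℂ] (X → ℂ) :=
  Fintype.linearCombination ℂ fun y => coordVecOn (ρ y)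

omit [DecidableEq Y] in
/-- The push-forward, as a sum over `Y`. -/
theorem pushMap_apply (ρ : Y → X) (w : Y → ℂ) : pushMap ρ w = ∑ y, w y • coordVecOn (ρ y) :=
  Fintype.linearCombination_apply _ _ _

/-- The push-forward carries the coordinate vector `e_y` to `e_{ρ y}`. -/
theorem pushMap_coordVecOn (ρ : Y → X) (y : Y) : pushMap ρ (coordVecOn y) = coordVecOn (ρ y) := by
  have h := Fintype.linearCombination_apply_single (R := ℂ) (v := fun y => coordVecOn (ρ y)) y (1 : ℂ)
  rw [one_smul] at h
  exact h

/-- **The exterior power of the push-forward carries coordinate wedges to coordinate wedges**: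
`⋀^n (pushMap ρ) e_{s 0} ∧ ⋯ ∧ e_{s (n−1)} = e_{ρ (s 0)} ∧ ⋯ ∧ e_{ρ (s (n−1))}`. -/
theorem map_pushMap_coordWedgeOn (ρ : Y → X) {n : ℕ} (s : Fin n → Y) :
    exteriorPower.map n (pushMap ρ) (coordWedgeOn n s) = coordWedgeOn n (ρ ∘ s) := by
  unfold coordWedgeOn
  rw [exteriorPower.map_apply_ιMulti]
  congr 1
  funext j
  simp only [Function.comp_apply, pushMap_coordVecOn]

end Push

/-! ### The corner family `φ_s`, `s ∈ Δ`, of a subset `Δ ⊆ X` (Milne p0005:L22–34) -/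

section Corner

variable {G : Type*} [Group G] [DecidableEq G] [Fintype G] {X : Type*} [MulAction G X] [DecidableEq X]

/-- Milne's `φ_s`: the CM type on `F` of the factor `A_s = A ⊗_{E,s} F`, «`φ_s(t) = φ(t ∘ s)`»
(p0005:L23–25) — on the `G`-set model the set `{t ∈ G : t • s ∈ Φ}`. -/
def cornerType (Φ : Finset X) (s : X) : Finset G := univ.filter fun t : G => t • s ∈ Φ

omit [DecidableEq G] in
/-- Membership in `φ_s`. -/
@[simp] theorem mem_cornerType {Φ : Finset X} {s : X} {t : G} :
    t ∈ cornerType Φ s ↔ t • s ∈ Φ := by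
  simp [cornerType]

omit [DecidableEq G] in
/-- `φ_s` is a CM type of `(G, c)` when `Φ` is a CM type on the `G`-set `X`. -/
theorem isCMType_cornerType {c : G} {Φ : Finset X} (hΦ : IsCMTypeOn c Φ) (s : X) :
    IsCMType c (cornerType Φ s) := by
  intro t
  rw [mem_cornerType, mem_cornerType, mul_smul]
  exact hΦ (t • s)

/-- The **corner family** of `Δ ⊆ X`: `s ∈ Δ ↦ φ_s`, the CM types of the factors of
`A_Δ = ∏_{s ∈ Δ} A_s` (p0005:L30–34), indexed by the corners `ι = Δ`. -/
def cornerFamily (Φ Δ : Finset X) : ↥Δ → Finset G := fun s => cornerType Φ (s : X)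

omit [DecidableEq G] in
/-- Every member of the corner family is a CM type. -/
theorem isCMType_cornerFamily {c : G} {Φ : Finset X} (hΦ : IsCMTypeOn c Φ) (Δ : Finset X) (s : ↥Δ) :
    IsCMType c (cornerFamily Φ Δ s) :=
  isCMType_cornerType hΦ (s : X)

/-- **André's map** `Δ × G → X`, `(s, t) ↦ t • s`: the embeddings of the CM algebra `F^Δ` of `A_Δ` sent
to the embeddings `t ∘ s` of `E` (p0005:L62–64, «`a ∈ E` acts … as multiplication by `∏_{s∈Δ}
(t ∘ s)(a)`»). -/
def andreMap (Δ : Finset X) : ↥Δ × G → X := fun q => q.2 • (q.1 : X)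

omit [DecidableEq G] [Fintype G] [DecidableEq X] in
/-- André's map, pointwise. -/
@[simp] theorem andreMap_apply (Δ : Finset X) (s : ↥Δ) (t : G) : andreMap Δ (s, t) = t • (s : X) := rfl

omit [DecidableEq G] in
/-- André's map is a type map (typer's `IsTypeMap`): `G`-equivariant in the embedding coordinate and
pulling `Φ` back to the corner family. -/
theorem isTypeMap_andreMap (Φ Δ : Finset X) :
    IsTypeMap (cornerFamily (G := G) Φ Δ) Φ (andreMap Δ) where
  equivariant k τ x := by
    simp only [andreMap_apply, mul_smul]
  mem_iff k x := by
    simp only [andreMap_apply, cornerFamily, mem_cornerType]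

omit [Fintype G] in
/-- André's map is injective on every `σ`-line set `{(s, σ) : s ∈ Δ}`. -/
theorem injOn_andreMap_lineSet (Δ : Finset X) (σ : G) :
    Set.InjOn (andreMap Δ) (↑(lineSet (ι := ↥Δ) σ) : Set (↥Δ × G)) := by
  intro q hq q' hq' h
  rw [Finset.mem_coe, mem_lineSet] at hq hq'
  simp only [andreMap] at h
  rw [hq, hq'] at h
  exact Prod.ext (Subtype.ext (smul_left_cancel σ h)) (hq.trans hq'.symm)

omit [Fintype G] in
/-- The image of the `σ`-line set under André's map is the translate `σ • Δ`. -/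
theorem image_andreMap_lineSet (Δ : Finset X) (σ : G) :
    (lineSet (ι := ↥Δ) σ).image (andreMap Δ) = σ • Δ := by
  ext y
  simp only [mem_image, mem_lineSet, mem_smul_finset]
  constructor
  · rintro ⟨⟨s, t⟩, ht, rfl⟩
    simp only at ht
    subst ht
    exact ⟨s, s.2, rfl⟩
  · rintro ⟨s, hs, rfl⟩
    exact ⟨(⟨s, hs⟩, σ), rfl, rfl⟩

/-- **Pohlmann's condition transfers along André's map**: `σ • Δ` is a Pohlmann set of `(X, Φ)` iff the
`σ`-line set of the corner product is a Pohlmann set of the product type (typer's `IsTypeMap`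
transfer). -/
theorem isHodgeSetOn_smul_iff_isHodgeSetProd_lineSet (c : G) (Φ Δ : Finset X) (σ : G) :
    IsHodgeSetOn c Φ (σ • Δ) ↔ IsHodgeSetProd c (cornerFamily Φ Δ) (lineSet (ι := ↥Δ) σ) := by
  rw [← image_andreMap_lineSet Δ σ]
  exact (isTypeMap_andreMap Φ Δ).isHodgeSetOn_image_iff c _ (injOn_andreMap_lineSet Δ σ)

omit [DecidableEq G] [Fintype G] in
/-- Pohlmann's condition for `Δ` is Pohlmann's condition for every translate `σ • Δ`. -/
theorem isHodgeSetOn_iff_forall_smul (c : G) (Φ Δ : Finset X) :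
    IsHodgeSetOn c Φ Δ ↔ ∀ σ : G, IsHodgeSetOn c Φ (σ • Δ) :=
  ⟨fun h σ => h.smul σ, fun h => by simpa only [one_smul] using h 1⟩

/-- **(eq2) for `Δ` is the constant-sum condition for its corner family** (Milne p0005:L26–30:
«Because `Δ` satisfies ((eq2)), `Σ_{s∈Δ} φ_s(t) = p`, all `t ∈ T`»): `Δ` is a Pohlmann set of `(X, Φ)`
iff every embedding `t ∈ G` lies in exactly `|Δ| / 2` of the corner types `φ_s`, `s ∈ Δ`. -/
theorem isHodgeSetOn_iff_sumP_cornerFamily {c : G} (hc : IsComplexConj c) {Φ : Finset X}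
    (hΦ : IsCMTypeOn c Φ) (Δ : Finset X) :
    IsHodgeSetOn c Φ Δ ↔ SumP (Δ.card / 2) (cornerFamily (G := G) Φ Δ) := by
  rw [isHodgeSetOn_iff_forall_smul, ← Fintype.card_coe Δ,
    ← forall_isHodgeSetProd_lineSet_iff_sumP hc (isCMType_cornerFamily hΦ Δ)]
  exact forall_congr' fun σ => isHodgeSetOn_smul_iff_isHodgeSetProd_lineSet c Φ Δ σ

/-- A Pohlmann `2p`-set has a `SumP p` corner family — the hypothesis under which night-1's Weil-space
theorems apply to `A_Δ`. -/
theorem sumP_cornerFamily {c : G} (hc : IsComplexConj c) {Φ : Finset X} (hΦ : IsCMTypeOn c Φ)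
    {Δ : Finset X} (hΔ : IsHodgeSetOn c Φ Δ) {p : ℕ} (hcard : Δ.card = 2 * p) :
    SumP p (cornerFamily (G := G) Φ Δ) := by
  have h := (isHodgeSetOn_iff_sumP_cornerFamily hc hΦ Δ).1 hΔ
  rwa [hcard, Nat.mul_div_cancel_left p two_pos] at h

end Corner

/-! ### The pull-back `f_Δ^*` on `H^{2p}` and the Weil space of `A_Δ` -/

section Pull

variable {G : Type*} [Group G] [DecidableEq G] [Fintype G] {X : Type*} [MulAction G X] [Fintype X]
  [DecidableEq X]

/-- **`f_Δ^*` on `H^n`**: the `n`-th exterior power of the push-forward along André's map,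
`⋀^n ℂ^{Δ × G} → ⋀^n ℂ^X` (Milne p0005:L63, «`f_Δ^* ⊗ 1 : H^{2p}(A_Δ) → H^{2p}(A)`»). -/
noncomputable def andrePull (Δ : Finset X) (n : ℕ) :
    ⋀[ℂ]^n ((↥Δ × G) → ℂ) →ₗ[ℂ] ⋀[ℂ]^n (X → ℂ) :=
  exteriorPower.map n (pushMap (andreMap Δ))

/-- An enumeration of the translate `σ • Δ` through an enumeration `e` of `Δ`: `j ↦ σ • e j`. -/
def deltaEnum {n : ℕ} (Δ : Finset X) (e : Fin n ≃ ↥Δ) (σ : G) : Fin n → X :=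
  fun j => σ • ((e j : ↥Δ) : X)

omit [DecidableEq G] [Fintype G] [Fintype X] [DecidableEq X] in
/-- The enumeration of `σ • Δ` is André's map after the enumeration of the `σ`-line. -/
theorem deltaEnum_eq_andreMap_comp_lineEnum {n : ℕ} (Δ : Finset X) (e : Fin n ≃ ↥Δ) (σ : G) :
    deltaEnum Δ e σ = andreMap Δ ∘ lineEnum e σ := rfl

omit [DecidableEq G] [Fintype G] [Fintype X] [DecidableEq X] in
/-- The enumeration of `σ • Δ` is injective. -/
theorem deltaEnum_injective {n : ℕ} (Δ : Finset X) (e : Fin n ≃ ↥Δ) (σ : G) :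
    Function.Injective (deltaEnum Δ e σ) := by
  intro a b h
  exact e.injective (Subtype.ext (smul_left_cancel σ h))

omit [Fintype G] [Fintype X] in
/-- The image of the enumeration is `σ • Δ`. -/
theorem image_deltaEnum {n : ℕ} (Δ : Finset X) (e : Fin n ≃ ↥Δ) (σ : G) :
    univ.image (deltaEnum Δ e σ) = σ • Δ := by
  rw [deltaEnum_eq_andreMap_comp_lineEnum, ← Finset.image_image, image_lineEnum,
    image_andreMap_lineSet]

omit [Fintype X] in
/-- **`f_Δ^*` carries the `σ`-line of `W_F(A_Δ)` to the Pohlmann wedge `e_{σ • Δ}`** (Milne p0005:L60–66: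
`H^{2p}(A_Δ)_{Δ×{t}}` is mapped into `H^{2p}(A)_{t∘Δ}`; on the kernel the line is mapped ONTO the
coordinate wedge). -/
theorem andrePull_weilWedgeProd {p : ℕ} (Δ : Finset X) (e : Fin (2 * p) ≃ ↥Δ) (σ : G) :
    andrePull Δ (2 * p) (weilWedgeProd e σ) = coordWedgeOn (2 * p) (deltaEnum Δ e σ) := by
  unfold andrePull weilWedgeProd
  rw [map_pushMap_coordWedgeOn]
  rfl

omit [Fintype X] in
/-- **The image of the Weil space of `A_Δ` under `f_Δ^*`** is the span of the Galois orbit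
`{e_{σ • Δ} : σ ∈ G}` of the Pohlmann wedge `e_Δ` (Milne p0005:L57–66). -/
theorem map_andrePull_weilSpaceProd {p : ℕ} (Δ : Finset X) (e : Fin (2 * p) ≃ ↥Δ) :
    (weilSpaceProd G p e).map (andrePull Δ (2 * p)) =
      Submodule.span ℂ (Set.range fun σ : G => coordWedgeOn (2 * p) (deltaEnum Δ e σ)) := by
  rw [weilSpaceProd, Submodule.map_span]
  congr 1
  ext ω
  constructor
  · rintro ⟨_, ⟨σ, rfl⟩, rfl⟩
    exact ⟨σ, (andrePull_weilWedgeProd Δ e σ).symm⟩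
  · rintro ⟨σ, rfl⟩
    exact ⟨weilWedgeProd e σ, ⟨σ, rfl⟩, andrePull_weilWedgeProd Δ e σ⟩

omit [Fintype X] in
/-- Every wedge `e_{σ • Δ}` — in particular `e_Δ = H^{2p}(A)_Δ` at `σ = 1` — lies in the image of the Weil
space of `A_Δ` (Milne p0005:L70–72: «contains `H^{2p}(A)_Δ`»). -/
theorem coordWedgeOn_deltaEnum_mem_map {p : ℕ} (Δ : Finset X) (e : Fin (2 * p) ≃ ↥Δ) (σ : G) :
    coordWedgeOn (2 * p) (deltaEnum Δ e σ) ∈ (weilSpaceProd G p e).map (andrePull Δ (2 * p)) :=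
  ⟨weilWedgeProd e σ, weilWedgeProd_mem_weilSpaceProd p e σ, andrePull_weilWedgeProd Δ e σ⟩

omit [Fintype G] in
/-- For a Pohlmann set `Δ`, every wedge `e_{σ • Δ}` is a joint `(p, p)`-class of all conjugate
cocharacters `μ_{g • Φ}` — a Hodge class of `A` in typer-2's dictionary (`H^{2p}(A)_{t∘Δ} ⊂ B^p(A) ⊗ ℚ^al`,
Milne p0005:L64–66). -/
theorem coordWedgeOn_deltaEnum_mem_jointEigenspaceOn {c : G} (hc : IsComplexConj c) {Φ : Finset X}
    (hΦ : IsCMTypeOn c Φ) {Δ : Finset X} (hΔ : IsHodgeSetOn c Φ Δ) {p : ℕ} (e : Fin (2 * p) ≃ ↥Δ)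
    (σ : G) : coordWedgeOn (2 * p) (deltaEnum Δ e σ) ∈ jointEigenspaceOn (fun g : G => g • Φ) (2 * p) p := by
  rw [mem_jointEigenspaceOn_iff]
  have h : IsHodgeSetOn c Φ (univ.image (deltaEnum Δ e σ)) := by
    rw [image_deltaEnum]
    exact hΔ.smul σ
  exact (isHodgeSetOn_iff_forall_map_cocharOn_smul_eq hc hΦ (deltaEnum_injective Δ e σ)).1 h

/-- **`f_Δ^*(W_F(A_Δ)) ⊗ ℂ ⊆ B^p(A) ⊗ ℂ`** (Milne p0005:L69–71): for a Pohlmann set `Δ` the pulled-back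
Weil space consists of Hodge classes of `A`. -/
theorem map_andrePull_weilSpaceProd_le {c : G} (hc : IsComplexConj c) {Φ : Finset X}
    (hΦ : IsCMTypeOn c Φ) {Δ : Finset X} (hΔ : IsHodgeSetOn c Φ Δ) {p : ℕ} (e : Fin (2 * p) ≃ ↥Δ) :
    (weilSpaceProd G p e).map (andrePull Δ (2 * p)) ≤ jointEigenspaceOn (fun g : G => g • Φ) (2 * p) p := by
  rw [map_andrePull_weilSpaceProd, Submodule.span_le]
  rintro _ ⟨σ, rfl⟩
  exact coordWedgeOn_deltaEnum_mem_jointEigenspaceOn hc hΦ hΔ e σ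

/-- **Theorem 1 (André 1992 / Milne 2020) on the kernel, complexified**: the space of Hodge classes of
`A` in degree `2p` (the joint `(p, p)`-eigenspace of the conjugate cocharacters `μ_{g • Φ}`, typer-2's
dictionary for `B^p(A) ⊗ ℂ`) is the sum, over the Pohlmann `2p`-sets `Δ ⊆ X` (with an enumeration `e`
of their corners), of the pulled-back Weil spaces `f_Δ^*(W_F(A_Δ)) ⊗ ℂ` of the corner products
`A_Δ = ∏_{s ∈ Δ} A_s` — «every Hodge class `t` on `A` can be written as a sum `t = Σ f_Δ^*(t_Δ)` with
`t_Δ` a Weil class on `A_Δ`» (p0005:L5–8), with S2 (Pohlmann's census, `(r4)(c)`) as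
`jointEigenspaceOn_smul_eq_span_pohlmannWedgesOn`. -/
theorem jointEigenspaceOn_eq_iSup_map_andrePull {c : G} (hc : IsComplexConj c) {Φ : Finset X}
    (hΦ : IsCMTypeOn c Φ) (p : ℕ) :
    jointEigenspaceOn (fun g : G => g • Φ) (2 * p) p =
      ⨆ (Δ : Finset X) (e : Fin (2 * p) ≃ ↥Δ) (_ : IsHodgeSetOn c Φ Δ),
        (weilSpaceProd G p e).map (andrePull Δ (2 * p)) := by
  refine le_antisymm ?_ ?_
  · rw [jointEigenspaceOn_smul_eq_span_pohlmannWedgesOn hc hΦ p, Submodule.span_le]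
    rintro _ ⟨s, hs, hS, rfl⟩
    have hcard : (univ.image s).card = 2 * p := by
      rw [card_image_of_injective _ hs, card_univ, Fintype.card_fin]
    have hinj : Function.Injective fun j : Fin (2 * p) =>
        (⟨s j, mem_image_of_mem s (mem_univ j)⟩ : ↥(univ.image s)) :=
      fun a b h => hs (congrArg Subtype.val h)
    have hbij : Function.Bijective fun j : Fin (2 * p) =>
        (⟨s j, mem_image_of_mem s (mem_univ j)⟩ : ↥(univ.image s)) := by
      rw [Fintype.bijective_iff_injective_and_card]
      exact ⟨hinj, by rw [Fintype.card_fin, Fintype.card_coe, hcard]⟩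
    let e : Fin (2 * p) ≃ ↥(univ.image s) := Equiv.ofBijective _ hbij
    have key : coordWedgeOn (2 * p) s = coordWedgeOn (2 * p) (deltaEnum (univ.image s) e (1 : G)) := by
      congr 1
      funext j
      simp only [deltaEnum, e, Equiv.ofBijective_apply, one_smul]
    rw [SetLike.mem_coe, key]
    exact Submodule.mem_iSup_of_mem (univ.image s) (Submodule.mem_iSup_of_mem e
      (Submodule.mem_iSup_of_mem hS (coordWedgeOn_deltaEnum_mem_map (univ.image s) e (1 : G))))
  · refine iSup_le fun Δ => iSup_le fun e => iSup_le fun hΔ => ?_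
    exact map_andrePull_weilSpaceProd_le hc hΦ hΔ e

end Pull

end HodgeRepro.RouteC
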